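import Mathlib
import Literature.NumberTheory.LFunctions.Zhang2022.RepairBedAssumptionAVacuousRange
import HarnessLib

/-!
# Zhang (2022), rescue BED/GAP (D-0124 (3)(4)): the vacuity range of the MINIMUM PREMISE of the main-term chain —
# `‖L(1,χ)‖ ≤ 𝓛⁻¹⁵` is false for every real primitive character of conductor `≤ e^{149}` (`> 10^{64}`)

Topic `Literature/NumberTheory/LFunctions/Zhang2022` (Landau–Siegel audit tree; verdict-neutral).
Y. Zhang, *Discrete mean estimates and the Landau–Siegel zero*, arXiv:2211.02515v1 (2022)
[Zhang2022LandauSiegel] — **an unrefereed manuscript under adjudication; nothing in this file asserts or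
denies its Theorems 1–2, and nothing here is a claim about Landau–Siegel zeros. The programme SEARCHES and
TYPES; no claim about Landau–Siegel zeros, Theorems 1–2 of arXiv:2211.02515 or a repaired Margin232 until a
kernel theorem says so.**

`RepairBedAssumptionAVacuousRange(Crossover)` make the bed's honesty rule (H2) a kernel fact for the PRINTED premise:
Assumption (A) (`‖L(1,χ)‖ < 𝓛⁻²⁰²²`) is false for every primitive quadratic `χ` of conductor `1 < q ≤ e^{43149}` (trivial
bound `L(1,χ_D) ≥ (3/4)/√|D|`, crossover `log q ≈ 4.3·10⁴`). The rescue's quantification located the premise the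
MAIN-TERM chain actually consumes — `‖L(1,χ)‖ ≤ 𝓛⁻¹⁵`, the Lemma 5.8 door (GAP G-31 «main terms only E ≥ 15»;
`Repair.Gap.lemma58_of_norm_le_pow15`, `…PartIIIDoors`, `…Lemma58ScaleLaw`: `E = 2x_P − 3`). This file gives THAT premise
its vacuity range, by the same trivial bound and a two-endpoint concavity check in place of the exp-chords:

* `log_mul_sub_half_ge_of_endpoints` — the engine: `u ↦ E·log u − u/2` is concave (`strictConcaveOn_log_Ioi`), so a
  lower bound `c` valid at both ends of `[a, b]` is valid on `[a, b]`; `mul_exp_half_le_pow_of_log` turns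
  `log C ≤ n log u − u/2` into `C·e^{u/2} ≤ uⁿ`;
* `exp_half_le_pow15` — `1.345·e^{u/2} ≤ u¹⁵` on `[1.09, 149]` (endpoints: `log 1.09 ≥ 1 − 1/1.09`, `log 149 ≥ 4.99`
  from `e < 2.7182818286` and `1 + x ≤ eˣ`); hence `one_div_log_pow15_lt_of_log_le`: for `3 ≤ D`, `log D ≤ 149`,
  **`1/(log D)^15 < (3/4)/√D`** (strict, since `4/3 < 1.345`);
* `not_norm_le_pow15_of_re_ge_sqrt` (any `χ (mod D)` with `Re L(1,χ) ≥ (3/4)/√D`), `…_kroneckerChar_of_log_natAbs_le`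
  (every fundamental `D`, `log|D| ≤ 149`, via `three_quarters_div_sqrt_le_LOne`), and
  **`pow15_lt_norm_LFunction_one_of_isPrimitive_isQuadratic`**: for EVERY primitive quadratic `χ (mod q)`, `1 < q`,
  `log q ≤ 149`: `(log q)^{−15} < ‖L(1,χ)‖` — so `‖L(1,χ)‖ ≤ 𝓛⁻¹⁵` fails (`not_norm_le_pow15_of_isPrimitive_isQuadratic_…`)
  and so does `Repair.Bed.AssumptionAWith 15` (`not_assumptionAWith15_…`).

READING (bed honesty rule H2 for the minimum premise; as-typed): every eventual statement of the tree guarded by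
`‖L(1,χ)‖ ≤ 𝓛⁻¹⁵` (the `…_pow15` twins of §§8–16) has content only at conductors `q > e^{149} ≈ 10^{64.7}` (true
crossover of the `h ≥ 1` bound for exponent 15: `log q ≈ 149.6`), exactly as the printed (A) has content only beyond
`e^{43149}`; no computation reaches either range. At scale exponent `x_P` (`…Lemma58ScaleLaw`) the same engine gives the
range of the premise `𝓛^{−(2x_P−3)}` from two endpoint checks. Nothing here is about (A) or about `L(1,χ)` beyond these
ranges. Theorems only; no definition, no named fact.

## References

* Y. Zhang, arXiv:2211.02515v1 (2022), §2 Assumption (A) p. 4; §5 Lemma 5.8. [cite: Zhang2022LandauSiegel, §2 Assumption (A); §5 Lemma 5.8]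
* H. Davenport, *Multiplicative Number Theory*, 2nd ed. (1980), Ch. 6 (class number formula). [cite: DavenportMNT1980, Ch. 6]
* H. L. Montgomery, R. C. Vaughan, *Multiplicative Number Theory I*, CUP 2007, Theorem 9.13.
  [cite: MontgomeryVaughan2007, Theorem 9.13]
-/

noncomputable section

open Complex Real DirichletCharacter

namespace Literature.NumberTheory.LFunctions.Zhang2022.Repair.Bed.Vacuity

open Skeleton Literature.NumberTheory.LFunctions.Zhang2022.Repair.Bed
open Literature.NumberTheory.LFunctions.KroneckerCharacter
open Literature.NumberTheory.QuadraticFields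

/-! ## The engine: two endpoint checks for the concave `u ↦ E·log u − u/2` -/

/-- **Two-endpoint check for `E·log u − u/2`.** For `E ≥ 0` and `0 < a ≤ u ≤ b`: if `c ≤ E log a − a/2` and
`c ≤ E log b − b/2` then `c ≤ E log u − u/2` (concavity of `log`: `log((1−t)a + tb) ≥ (1−t)log a + t log b`, and
`u/2` is affine). [folklore] -/
private theorem log_mul_sub_half_ge_of_endpoints {E c a b u : ℝ} (hE : 0 ≤ E) (ha : 0 < a) (hau : a ≤ u)
    (hub : u ≤ b) (hca : c ≤ E * Real.log a - a / 2) (hcb : c ≤ E * Real.log b - b / 2) :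
    c ≤ E * Real.log u - u / 2 := by
  rcases eq_or_lt_of_le (hau.trans hub) with hab | hab
  · have hua : u = a := le_antisymm (hab ▸ hub) hau
    rw [hua]; exact hca
  · have hba : 0 < b - a := sub_pos.mpr hab
    set t : ℝ := (u - a) / (b - a) with ht
    have ht0 : 0 ≤ t := div_nonneg (sub_nonneg.mpr hau) hba.le
    have ht1 : t ≤ 1 := by rw [ht, div_le_one hba]; linarith
    have hu : (1 - t) * a + t * b = u := by
      rw [ht]; field_simp; ring
    have hb : 0 < b := lt_of_lt_of_le ha (hau.trans hub)
    have hconc := strictConcaveOn_log_Ioi.concaveOn.2 (Set.mem_Ioi.mpr ha) (Set.mem_Ioi.mpr hb)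
      (sub_nonneg.mpr ht1) ht0 (by ring)
    simp only [smul_eq_mul] at hconc
    rw [hu] at hconc
    have h1 : c ≤ (1 - t) * (E * Real.log a - a / 2) + t * (E * Real.log b - b / 2) := by
      have := add_le_add (mul_le_mul_of_nonneg_left hca (sub_nonneg.mpr ht1))
        (mul_le_mul_of_nonneg_left hcb ht0)
      linarith
    have h2 : (1 - t) * (E * Real.log a - a / 2) + t * (E * Real.log b - b / 2) =
        E * ((1 - t) * Real.log a + t * Real.log b) - ((1 - t) * a + t * b) / 2 := by ring
    rw [h2, hu] at h1
    have h3 : E * ((1 - t) * Real.log a + t * Real.log b) ≤ E * Real.log u :=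
      mul_le_mul_of_nonneg_left hconc hE
    linarith

/-- **From logarithms to the exponential comparison**: `log C ≤ n log u − u/2` (`C, u > 0`) gives
`C·e^{u/2} ≤ uⁿ`. [folklore] -/
private theorem mul_exp_half_le_pow_of_log {C u : ℝ} {n : ℕ} (hC : 0 < C) (hu : 0 < u)
    (h : Real.log C ≤ n * Real.log u - u / 2) : C * Real.exp (u / 2) ≤ u ^ n := by
  have h' : Real.log C + u / 2 ≤ n * Real.log u := by linarith
  have h1 : Real.exp (Real.log C + u / 2) ≤ Real.exp (n * Real.log u) := Real.exp_le_exp.mpr h'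
  rw [Real.exp_add, Real.exp_log hC] at h1
  have h2 : Real.exp (n * Real.log u) = u ^ n := by
    rw [mul_comm, ← Real.rpow_def_of_pos hu, Real.rpow_natCast]
  rw [h2] at h1
  exact h1

/-! ## Numerals: `log 3 ≥ 1.09`, `log 149 ≥ 4.99` -/

/-- `e^{1.09} ≤ 3` (`e < 2.7182818286`, `e^{0.09} ≤ 1/0.91`). [folklore] -/
private theorem exp_109_le_three : Real.exp 1.09 ≤ 3 := by
  have h1 := Real.exp_one_lt_d9
  have h2 : (-0.09 : ℝ) + 1 ≤ Real.exp (-0.09) := Real.add_one_le_exp (-0.09)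
  have h3 : Real.exp 0.09 ≤ 1 / 0.91 := by
    have hpos : 0 < Real.exp (-0.09) := Real.exp_pos _
    have : Real.exp 0.09 = 1 / Real.exp (-0.09) := by
      rw [Real.exp_neg, one_div, inv_inv]
    rw [this]
    exact one_div_le_one_div_of_le (by norm_num) (by linarith)
  have hsplit : Real.exp 1.09 = Real.exp 1 * Real.exp 0.09 := by
    rw [← Real.exp_add]; norm_num
  rw [hsplit]
  calc Real.exp 1 * Real.exp 0.09 ≤ 2.7182818286 * (1 / 0.91) :=
        mul_le_mul h1.le h3 (Real.exp_pos _).le (by norm_num)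
    _ ≤ 3 := by norm_num

/-- `log 3 ≥ 1.09`. [folklore] -/
private theorem log_three_ge : (1.09 : ℝ) ≤ Real.log 3 := by
  rw [Real.le_log_iff_exp_le (by norm_num)]; exact exp_109_le_three

/-- `e^{4.99} ≤ 149` (`e^5 < 2.7182818286^5 < 148.414`, `e^{−0.01} ≤ 1/1.01`). [folklore] -/
private theorem exp_499_le : Real.exp 4.99 ≤ 149 := by
  have h1 := Real.exp_one_lt_d9
  have h5 : Real.exp 5 < 2.7182818286 ^ 5 := by
    rw [show (5 : ℝ) = ((5 : ℕ) : ℝ) * 1 by norm_num, Real.exp_nat_mul]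
    exact pow_lt_pow_left₀ h1 (Real.exp_pos 1).le (by norm_num)
  have h2 : (0.01 : ℝ) + 1 ≤ Real.exp 0.01 := Real.add_one_le_exp 0.01
  have h3 : Real.exp (-0.01) ≤ 1 / 1.01 := by
    rw [Real.exp_neg, ← one_div]
    exact one_div_le_one_div_of_le (by norm_num) (by linarith)
  have hsplit : Real.exp 4.99 = Real.exp 5 * Real.exp (-0.01) := by
    rw [← Real.exp_add]; norm_num
  rw [hsplit]
  calc Real.exp 5 * Real.exp (-0.01) ≤ 2.7182818286 ^ 5 * (1 / 1.01) :=
        mul_le_mul h5.le h3 (Real.exp_pos _).le (by positivity)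
    _ ≤ 149 := by norm_num

/-- `log 149 ≥ 4.99`. [folklore] -/
private theorem log_149_ge : (4.99 : ℝ) ≤ Real.log 149 := by
  rw [Real.le_log_iff_exp_le (by norm_num)]; exact exp_499_le

/-! ## The analytic comparison `(log D)^{−15} < (3/4)/√D` below `e^{149}` -/

/-- On `[1.09, 149]`: `0.345 ≤ 15 log u − u/2` (two endpoint checks: `15(1 − 1/1.09) − 0.545 ≥ 0.69` and
`15·4.99 − 74.5 = 0.35`). [folklore] -/
private theorem endpoints_fifteen {u : ℝ} (hlo : 1.09 ≤ u) (hhi : u ≤ 149) :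
    0.345 ≤ 15 * Real.log u - u / 2 := by
  refine log_mul_sub_half_ge_of_endpoints (by norm_num) (by norm_num) hlo hhi ?_ ?_
  · have h : 1 - (1.09 : ℝ)⁻¹ ≤ Real.log 1.09 := Real.one_sub_inv_le_log_of_pos (by norm_num)
    have hinv : (1.09 : ℝ)⁻¹ = 100 / 109 := by norm_num
    rw [hinv] at h
    linarith
  · have h := log_149_ge
    linarith

/-- **`1.345·e^{u/2} ≤ u^15` for `1.09 ≤ u ≤ 149`** (`log 1.345 ≤ 0.345 ≤ 15 log u − u/2`). [folklore] -/
private theorem exp_half_le_pow15 {u : ℝ} (hlo : 1.09 ≤ u) (hhi : u ≤ 149) :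
    1.345 * Real.exp (u / 2) ≤ u ^ 15 := by
  have hu : 0 < u := by linarith
  refine mul_exp_half_le_pow_of_log (by norm_num) hu ?_
  have hc : Real.log 1.345 ≤ 0.345 := by
    have := Real.log_le_sub_one_of_pos (by norm_num : (0 : ℝ) < 1.345)
    linarith
  have h := endpoints_fifteen hlo hhi
  push_cast
  linarith

/-- **For `3 ≤ D` with `log D ≤ 149`: `1/(log D)^15 < (3/4)/√D`** (`√D = e^{(log D)/2}`, `4/3 < 1.345`). [folklore] -/
private theorem one_div_log_pow15_lt_of_log_le {D : ℕ} (h3 : 3 ≤ D) (hlog : Real.log D ≤ 149) :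
    1 / Real.log D ^ 15 < (3 / 4 : ℝ) / Real.sqrt D := by
  have hD : (0 : ℝ) < D := by exact_mod_cast (show 0 < D by omega)
  have hu : (1.09 : ℝ) ≤ Real.log D :=
    le_trans log_three_ge (Real.log_le_log (by norm_num) (by exact_mod_cast h3))
  have hmain := exp_half_le_pow15 hu hlog
  have hsq : Real.exp (Real.log D / 2) ^ 2 = D := by
    rw [← Real.exp_nat_mul]; push_cast
    rw [show (2 : ℝ) * (Real.log D / 2) = Real.log D by ring, Real.exp_log hD]
  have hsqrt : Real.sqrt D = Real.exp (Real.log D / 2) := by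
    have := Real.sqrt_sq (Real.exp_pos (Real.log D / 2)).le
    rwa [hsq] at this
  have hlogpos : 0 < Real.log D := by linarith
  have hpow : 0 < Real.log D ^ 15 := pow_pos hlogpos _
  have hs : 0 < Real.sqrt D := Real.sqrt_pos.mpr hD
  rw [div_lt_div_iff₀ hpow hs, one_mul, hsqrt]
  have he : 0 < Real.exp (Real.log D / 2) := Real.exp_pos _
  linarith

/-! ## The generic statement below `e^{149}` -/

/-- **`Re L(1,χ) ≥ (3/4)/√D` rules out `‖L(1,χ)‖ ≤ (log D)^{−15}` at any modulus `3 ≤ D ≤ e^{149}`**, for ANY Dirichlet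
character `χ (mod D)`: `‖L(1,χ)‖ ≥ Re L(1,χ) ≥ (3/4)/√D > 1/(log D)^15`. The `E = 15` analogue of
`not_assumptionA_of_re_ge_sqrt`. [cite: Zhang2022LandauSiegel, §5 Lemma 5.8] -/
theorem not_norm_le_pow15_of_re_ge_sqrt {D : ℕ} [NeZero D] (χ : DirichletCharacter ℂ D) (h3 : 3 ≤ D)
    (hlog : Real.log D ≤ 149) (h : (3 / 4 : ℝ) / Real.sqrt D ≤ (χ.LFunction 1).re) :
    ¬ ‖χ.LFunction 1‖ ≤ 1 / Real.log D ^ 15 := by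
  intro h15
  have hre : (χ.LFunction 1).re ≤ ‖χ.LFunction 1‖ := Complex.re_le_norm _
  have hcmp := one_div_log_pow15_lt_of_log_le h3 hlog
  linarith

/-- The cast of `Int.natAbs` to `ℝ` is the absolute value. [folklore] -/
private theorem cast_natAbs_eq_abs' (D : ℤ) : ((D.natAbs : ℕ) : ℝ) = |(D : ℝ)| := by
  rw [← Int.cast_natCast, Int.natCast_natAbs, Int.cast_abs]

/-- **`‖L(1,χ_D)‖ ≤ (log|D|)^{−15}` is false at `χ_D = kroneckerChar D` for EVERY fundamental discriminant with
`log|D| ≤ 149`** (`L(1,χ_D) = LOne D ≥ (3/4)/√|D|`, `three_quarters_div_sqrt_le_LOne`).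
[cite: Zhang2022LandauSiegel, §5 Lemma 5.8] [cite: DavenportMNT1980, Ch. 6] -/
theorem not_norm_le_pow15_kroneckerChar_of_log_natAbs_le {D : ℤ}
    (hfd : Literature.Barriers.RiemannHypothesis.IsFundamentalDiscriminant D) (hlog : Real.log D.natAbs ≤ 149) :
    ∃ h0 : D ≠ 0, haveI : NeZero D.natAbs := ⟨Int.natAbs_ne_zero.mpr h0⟩
      ¬ ‖(kroneckerChar D).LFunction (1 : ℂ)‖ ≤ 1 / Real.log D.natAbs ^ 15 := by
  have h0 : D ≠ 0 := by
    rintro rfl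
    rcases hfd with ⟨h1, -, -⟩ | ⟨-, h23, -⟩ <;> omega
  have h3 : 3 ≤ D.natAbs := by
    by_contra hlt
    have hD : D = -2 ∨ D = -1 ∨ D = 0 ∨ D = 1 ∨ D = 2 := by omega
    rcases hD with rfl | rfl | rfl | rfl | rfl <;>
      rcases hfd with ⟨h1, -, h1ne⟩ | ⟨h4, h23, -⟩ <;> omega
  haveI : NeZero D.natAbs := ⟨Int.natAbs_ne_zero.mpr h0⟩
  refine ⟨h0, not_norm_le_pow15_of_re_ge_sqrt _ h3 hlog ?_⟩
  rw [← LOne_eq_re h0, cast_natAbs_eq_abs']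
  exact three_quarters_div_sqrt_le_LOne hfd

/-- **For EVERY primitive quadratic Dirichlet character `χ` of modulus `1 < q` with `log q ≤ 149`:
`‖L(1,χ)‖ ≤ (log q)^{−15}` is false** — `χ` is `χ_D` moved to level `q` (`changeLevel_kroneckerChar_eq`, empty Euler
correction), and `not_norm_le_pow15_kroneckerChar_of_log_natAbs_le`. The minimum premise of the main-term chain
(GAP G-31, E = 15) is refuted pointwise by `h ≥ 1` alone below `e^{149} ≈ 10^{64.7}`; nothing about larger `q`.
[cite: Zhang2022LandauSiegel, §5 Lemma 5.8] [cite: MontgomeryVaughan2007, Theorem 9.13] -/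
theorem not_norm_le_pow15_of_isPrimitive_isQuadratic_of_log_le {q : ℕ} [NeZero q] {χ : DirichletCharacter ℂ q}
    (hprim : χ.IsPrimitive) (hquad : χ.IsQuadratic) (h1 : 1 < q) (hlog : Real.log q ≤ 149) :
    ¬ ‖χ.LFunction 1‖ ≤ 1 / Real.log q ^ 15 := by
  obtain ⟨s, hpar, hs, hfd, hDq⟩ := exists_sign_fundamental hprim hquad h1
  have h0 : s * (q : ℤ) ≠ 0 := by
    intro h; rw [h] at hDq; simp at hDq; exact (NeZero.ne q) hDq.symm
  haveI hne : NeZero (s * (q : ℤ)).natAbs := ⟨Int.natAbs_ne_zero.mpr h0⟩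
  have hdvd : (s * (q : ℤ)).natAbs ∣ q := by rw [hDq]
  -- (1) χ is the Kronecker character moved to level q
  have hχ := changeLevel_kroneckerChar_eq hprim hquad hpar hfd hdvd hDq
  -- (2) the L-values agree (empty Euler correction)
  have hL : (changeLevel hdvd (kroneckerChar (s * q))).LFunction 1 = (kroneckerChar (s * q)).LFunction 1 := by
    rw [LFunction_changeLevel hdvd _ (Or.inl (kroneckerChar_ne_one hfd))]
    have hprod : ∏ p ∈ q.primeFactors, (1 - kroneckerChar (s * q) (p : ZMod (s * (q : ℤ)).natAbs) *
        (p : ℂ) ^ (-(1 : ℂ))) = 1 := by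
      refine Finset.prod_eq_one fun p hp => ?_
      have hpp : p.Prime := Nat.prime_of_mem_primeFactors hp
      have hpq : p ∣ (s * (q : ℤ)).natAbs := by rw [hDq]; exact Nat.dvd_of_mem_primeFactors hp
      have hnu : ¬ IsUnit ((p : ℕ) : ZMod (s * (q : ℤ)).natAbs) := by
        rw [ZMod.isUnit_prime_iff_not_dvd hpp]; exact fun h => h hpq
      rw [MulChar.map_nonunit _ hnu, zero_mul, sub_zero]
    rw [hprod, mul_one]
  -- (3) the Kronecker character violates the premise; transport
  obtain ⟨h0', hκ⟩ := not_norm_le_pow15_kroneckerChar_of_log_natAbs_le hfd (by rw [hDq]; exact hlog)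
  intro hA
  apply hκ
  rw [← hL, hχ]
  have hcast : ((s * (q : ℤ)).natAbs : ℝ) = (q : ℝ) := by exact_mod_cast hDq
  rw [hcast]
  exact hA

/-- **Positive form: `(log q)^{−15} < ‖L(1,χ)‖` for every primitive quadratic `χ (mod q)`, `1 < q`, `log q ≤ 149`.**
A Siegel-type lower bound with exponent 15 and constant 1, trivially, up to `q ≈ 10^{64.7}`.
[cite: Zhang2022LandauSiegel, §5 Lemma 5.8] [cite: MontgomeryVaughan2007, Theorem 9.13] -/
theorem pow15_lt_norm_LFunction_one_of_isPrimitive_isQuadratic {q : ℕ} [NeZero q] {χ : DirichletCharacter ℂ q}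
    (hprim : χ.IsPrimitive) (hquad : χ.IsQuadratic) (h1 : 1 < q) (hlog : Real.log q ≤ 149) :
    1 / Real.log q ^ 15 < ‖χ.LFunction 1‖ :=
  lt_of_not_ge (not_norm_le_pow15_of_isPrimitive_isQuadratic_of_log_le hprim hquad h1 hlog)

/-- **`Repair.Bed.AssumptionAWith 15 q χ` is false for every primitive quadratic `χ (mod q)`, `1 < q`, `log q ≤ 149`**
(`AssumptionAWith 15`: `‖L(1,χ)‖ < (log q)^{−15}`, real exponent). The `E = 15` column of the bed's (H2) table next to the
printed `E = 2022` (`not_assumptionA_of_isPrimitive_isQuadratic_of_log_le'`, `log q ≤ 43149`).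
[cite: Zhang2022LandauSiegel, §2 Assumption (A); §5 Lemma 5.8] -/
theorem not_assumptionAWith15_of_isPrimitive_isQuadratic_of_log_le {q : ℕ} [NeZero q]
    {χ : DirichletCharacter ℂ q} (hprim : χ.IsPrimitive) (hquad : χ.IsQuadratic) (h1 : 1 < q)
    (hlog : Real.log q ≤ 149) : ¬ AssumptionAWith 15 q χ := by
  intro hA
  unfold AssumptionAWith at hA
  have hcast : Real.log q ^ (15 : ℝ) = Real.log q ^ (15 : ℕ) := by
    rw [show (15 : ℝ) = ((15 : ℕ) : ℝ) by norm_num, Real.rpow_natCast]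
  rw [hcast] at hA
  exact not_norm_le_pow15_of_isPrimitive_isQuadratic_of_log_le hprim hquad h1 hlog hA.le

/-- **Decimal corollary: `‖L(1,χ)‖ ≤ (log q)^{−15}` is false for every primitive quadratic `χ` of modulus
`1 < q ≤ 10^64`** (`log q ≤ 64·log 10 < 64·2.3105 = 147.9 ≤ 149`; stated on the real cast).
[cite: Zhang2022LandauSiegel, §5 Lemma 5.8] [cite: MontgomeryVaughan2007, Theorem 9.13] -/
theorem not_norm_le_pow15_of_isPrimitive_isQuadratic_le_pow64 {q : ℕ} [NeZero q] {χ : DirichletCharacter ℂ q}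
    (hprim : χ.IsPrimitive) (hquad : χ.IsQuadratic) (h1 : 1 < q) (hq : (q : ℝ) ≤ (10 : ℝ) ^ 64) :
    ¬ ‖χ.LFunction 1‖ ≤ 1 / Real.log q ^ 15 := by
  refine not_norm_le_pow15_of_isPrimitive_isQuadratic_of_log_le hprim hquad h1 ?_
  have hq0 : (0 : ℝ) < q := by exact_mod_cast (show 0 < q by omega)
  have hle : Real.log q ≤ Real.log ((10 : ℝ) ^ 64) := Real.log_le_log hq0 hq
  rw [Real.log_pow] at hle
  -- `log 10 < 2.3105`: `log 1000 ≤ log 1024 = 10 log 2`, `log 2 < 0.6931471808`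
  have h2 := Real.log_two_lt_d9
  have h10 : Real.log 10 < 2.3105 := by
    have h1000 : Real.log 1000 ≤ Real.log 1024 := Real.log_le_log (by norm_num) (by norm_num)
    rw [show (1000 : ℝ) = 10 ^ 3 by norm_num, show (1024 : ℝ) = 2 ^ 10 by norm_num, Real.log_pow,
      Real.log_pow] at h1000
    push_cast at h1000
    linarith
  push_cast at hle
  nlinarith

end Literature.NumberTheory.LFunctions.Zhang2022.Repair.Bed.Vacuity
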